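import Literature.NumberTheory.Sieve.FriedlanderIwaniecPrimesUdDecomposition
import HarnessLib

/-!
# Friedlander–Iwaniec, *The polynomial `X² + Y⁴` captures its primes*, §16 (16.6) and (16.10): the separable block
# `ΣΣ_{4d ∣ Δ} β_{z₁} β_{z₂} ((z₂/z₁)/d) u(α₁ - α₂)` — no cutoff `f`, no coprimality — and its harmonics

Source: J. Friedlander, H. Iwaniec, Ann. of Math. (2) 148 (1998), 945–1040 [FriedlanderIwaniecAnnals1998]
(= arXiv:math/9811185), §16 p. 59:

> "Now we remove the condition `(z₁, z₂) = 1` which costs us `O(d⁻¹P⁻¹N²)` by a trivial estimation using (5.8).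
> Moreover by a trivial estimation we can remove the terms of (16.4) near the diagonal, say those with
> `|α₂ - α₁| < 2πH⁻¹`, at the cost of `O(d⁻¹H⁻¹N²)`. This can be done smoothly by means of a function `h(α)` …
> We obtain (16.6) `U_d(β) = Σ_{ω (mod 4d)} (ω/d) ΣΣ_{z₁ ≡ ω z₂ (mod 4d)} β_{z₁} β̄_{z₂} u(α₁ - α₂) + O(d⁻¹(P⁻¹ + H⁻¹)N²)`
> where … (16.7) `u(α) = -h(α) log ½|sin α|`.  Note that the factor `f(|Δ|/d)` is not needed in (16.6). …
> (16.10) `U_d(β) = Σ_{|k| ≤ K} û(k) Σ_ω (ω/d) ΣΣ_{z₁ ≡ ω z₂ (mod 4d)} β_{z₁} β̄_{z₂} (z₁z̄₂/|z₁z₂|)^k + O(…)`."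

`…UdDecomposition` typed `U_d` ((16.2), `fiUd`) and its mollification `fiUdMoll` still carrying the cutoff
`f(|Δ|/d)` and the condition `(z₁,z₂) = 1`.  The main term of (16.6) as PRINTED carries neither (the congruence
`z₁ ≡ ω z₂ (4d)` summed against `(ω/d)` is `[4d ∣ Δ]·((z₂/z₁)/d)`, (16.3)–(16.4), `…CharacterDetection`), which is
what makes it a hermitian form in `z₁`, `z₂` to which the character detection (16.11) applies.  This file PROVES:

* `fiUd0 H d S b = ΣΣ_{z₁,z₂ ∈ S, 4d ∣ Δ} b_{z₁} b_{z₂} χ_d(z₂/z₁) u_H(α₁ - α₂)` — the printed main term of (16.6)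
  (`χ_d = fiChi d`, `u_H = logSineMollifier H`, `α = gaussArg`); the pairs with `Δ = 0` (allowed by `4d ∣ Δ`)
  contribute nothing because `u_H` vanishes where `sin(α₁ - α₂) = 0`
  (`logSineMollifier_gaussArg_sub_eq_zero_of_fiDelta_eq_zero`, `fiUd0_eq_sum_fiModuli`; `0 ∉ S`);
* **the pointwise cost of dropping `f` and `(z₁,z₂) = 1`**: `abs_fiUdMoll_sub_fiUd0_le` —
  `|U_d^{(H)} - U_d^{0,(H)}| ≤ log(4H) · ΣΣ_{4d ∣ Δ ≠ 0, (z₁,z₂) ≠ 1 or |Δ| < 4dX} |b_{z₁} b_{z₂}|` (`H ≥ 1`, `X > 0`,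
  `d ≥ 1`, `0 ∉ S`): the non-coprime pairs (print: `O(d⁻¹P⁻¹N²)` via (5.8)) and the pairs with `|Δ| < 4dX`, which
  are near-diagonal (`|sin(α₂ - α₁)| < 4dX/|z₁z₂|`; print: "the factor `f(|Δ|/d)` is not needed in (16.6)");
* the harmonics of (16.10): `fiSd0 d S b k = ΣΣ_{4d ∣ Δ} b_{z₁} b_{z₂} χ_d(z₂/z₁) (z₁z̄₂/(|z₁||z₂|))^k`,
  `harmonic_pair_eq` (`(z₁z̄₂/(|z₁||z₂|))^k = (z₁/|z₁|)^k · conj((z₂/|z₂|)^k)`, the hermitian shape consumed by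
  `sum_sum_dvd_im_conj_eq_sum_mulChar`), and **`exists_fiUd0_trunc`** ((16.9) ⇒ (16.10) for the printed block:
  `‖U_d^{0,(H)} - Σ_{|k| ≤ K} û_H(k) S_d^0(k)‖ ≤ C·H·log(4H)·K⁻¹ ΣΣ_{4d∣Δ} |b_{z₁}b_{z₂}χ|`, one `û_H` per `H ≥ 2`).

No named facts, no `sorry`.

## References
* J. Friedlander, H. Iwaniec, Ann. of Math. (2) 148 (1998), 945–1040, §16 (16.6)–(16.7), (16.10).
  [FriedlanderIwaniecAnnals1998]

## Tree / Mathlib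
Tree: `fiUdMoll`, `fiUdWeight` (`…UdDecomposition`), `fiDelta`, `fiChi`, `fiModuli`, `fiTenF`, `fiTenF_eq_one`,
`fiTenF_mem_Icc`, `GaussCoprime` (`…MainTermSplit`), `fiDelta_eq_fiAbsProd_mul_sin`, `fiAbsProd_eq_norm_mul`
(`…LogSineKernel`), `logSineCutoff_eq_zero`, `logSineMollifier_mem_Icc` (`…LogSineMollifier`),
`exists_logSineMollifier_separation`, `exp_int_mul_arg_sub_mul_I` (`…LogSineSeparation`). Mathlib: `map_zpow₀`,
`div_zpow`, `mul_zpow`, `Nat.mem_divisors`, `jacobiSym.trichotomy`.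
-/

noncomputable section

open Real Complex Finset
open scoped ComplexConjugate NumberTheorySymbols

namespace Literature.NumberTheory.Sieve.FriedlanderIwaniecPrimes

/-! ### The printed main term of (16.6) -/

/-- **(16.6), main term**: `U_d^{0,(H)}(β) = ΣΣ_{z₁,z₂ ∈ S, 4d ∣ Δ(z₁,z₂)} b_{z₁} b_{z₂} ((z₂/z₁)/d) u_H(α₁ - α₂)`.
[cite: FriedlanderIwaniecAnnals1998, (16.6)–(16.7)] -/
def fiUd0 (H : ℝ) (d : ℕ) (S : Finset GaussianInt) (b : GaussianInt → ℝ) : ℝ :=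
  ∑ z₁ ∈ S, ∑ z₂ ∈ S,
    if (4 * (d : ℤ)) ∣ fiDelta z₁ z₂ then
      b z₁ * b z₂ * (fiChi d z₁ z₂ : ℝ) * logSineMollifier H (gaussArg z₁ - gaussArg z₂)
    else 0

/-- Pairs with `Δ = 0` do not contribute: `u_H(α₁ - α₂) = 0` when `Δ(z₁,z₂) = |z₁z₂| sin(α₂ - α₁) = 0`, `z₁, z₂ ≠ 0`
("`h` vanishing at `α = 0`"). [cite: FriedlanderIwaniecAnnals1998, §15 before (15.6) and (16.5)] -/
theorem logSineMollifier_gaussArg_sub_eq_zero_of_fiDelta_eq_zero (H : ℝ) {z₁ z₂ : GaussianInt} (hz₁ : z₁ ≠ 0)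
    (hz₂ : z₂ ≠ 0) (hΔ : fiDelta z₁ z₂ = 0) : logSineMollifier H (gaussArg z₁ - gaussArg z₂) = 0 := by
  have h := fiDelta_eq_fiAbsProd_mul_sin z₁ z₂
  rw [hΔ, Int.cast_zero, fiAbsProd_eq_norm_mul] at h
  have hz₁' : GaussianInt.toComplex z₁ ≠ 0 := fun h0 => hz₁ (GaussianInt.toComplex_eq_zero.mp h0)
  have hz₂' : GaussianInt.toComplex z₂ ≠ 0 := fun h0 => hz₂ (GaussianInt.toComplex_eq_zero.mp h0)
  have hA : 0 < ‖GaussianInt.toComplex z₁‖ * ‖GaussianInt.toComplex z₂‖ :=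
    mul_pos (norm_pos_iff.mpr hz₁') (norm_pos_iff.mpr hz₂')
  have hsin : Real.sin (gaussArg z₂ - gaussArg z₁) = 0 := by
    rcases mul_eq_zero.mp h.symm with h0 | h0
    · exact absurd h0 hA.ne'
    · exact h0
  have hsin' : Real.sin (gaussArg z₁ - gaussArg z₂) = 0 := by
    rw [← neg_sub, Real.sin_neg, hsin, neg_zero]
  unfold logSineMollifier
  rw [logSineCutoff_eq_zero (by rw [hsin']; norm_num), zero_mul]

/-- `d ∈ fiModuli z₁ z₂ ↔ 4d ∣ Δ ≠ 0`. [folklore] -/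
private theorem us_mem_fiModuli_iff {z₁ z₂ : GaussianInt} {d : ℕ} :
    d ∈ fiModuli z₁ z₂ ↔ (4 * (d : ℤ)) ∣ fiDelta z₁ z₂ ∧ fiDelta z₁ z₂ ≠ 0 := by
  unfold fiModuli
  rw [mem_filter, Nat.mem_divisors]
  constructor
  · rintro ⟨⟨-, hne⟩, h4⟩
    exact ⟨h4, fun h0 => hne (by rw [h0]; rfl)⟩
  · rintro ⟨h4, hne⟩
    refine ⟨⟨?_, fun h0 => hne (Int.natAbs_eq_zero.mp h0)⟩, h4⟩
    have h1 : (d : ℤ) ∣ fiDelta z₁ z₂ := (Dvd.intro_left _ rfl : (d : ℤ) ∣ 4 * (d : ℤ)).trans h4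
    exact Int.natCast_dvd.mp h1

/-- `U_d^{0,(H)}` restricted to `Δ ≠ 0` (i.e. to `d ∈ fiModuli`), when `0 ∉ S`. [cite: FriedlanderIwaniecAnnals1998, (16.6)] -/
theorem fiUd0_eq_sum_fiModuli (H : ℝ) (d : ℕ) {S : Finset GaussianInt}
    (h0 : (0 : GaussianInt) ∉ S) (b : GaussianInt → ℝ) :
    fiUd0 H d S b = ∑ z₁ ∈ S, ∑ z₂ ∈ S,
      if d ∈ fiModuli z₁ z₂ then
        b z₁ * b z₂ * (fiChi d z₁ z₂ : ℝ) * logSineMollifier H (gaussArg z₁ - gaussArg z₂)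
      else 0 := by
  unfold fiUd0
  refine sum_congr rfl fun z₁ hz₁ => sum_congr rfl fun z₂ hz₂ => ?_
  have hz₁0 : z₁ ≠ 0 := fun h => h0 (h ▸ hz₁)
  have hz₂0 : z₂ ≠ 0 := fun h => h0 (h ▸ hz₂)
  by_cases h4 : (4 * (d : ℤ)) ∣ fiDelta z₁ z₂
  · by_cases hΔ : fiDelta z₁ z₂ = 0
    · rw [if_pos h4, if_neg (fun h => (us_mem_fiModuli_iff.mp h).2 hΔ),
        logSineMollifier_gaussArg_sub_eq_zero_of_fiDelta_eq_zero H hz₁0 hz₂0 hΔ, mul_zero]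
    · rw [if_pos h4, if_pos (us_mem_fiModuli_iff.mpr ⟨h4, hΔ⟩)]
  · rw [if_neg h4, if_neg (fun h => h4 (us_mem_fiModuli_iff.mp h).1)]

/-! ### The cost of dropping `f(|Δ|/d)` and `(z₁, z₂) = 1` -/

/-- `|χ_d| ≤ 1`. [folklore] -/
private theorem us_abs_fiChi_le (d : ℕ) (z₁ z₂ : GaussianInt) : |(fiChi d z₁ z₂ : ℝ)| ≤ 1 := by
  unfold fiChi
  rcases jacobiSym.trichotomy (ratioClass (4 * d) z₂ z₁) (d / 2 ^ d.factorization 2) with h | h | h <;>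
    rw [h] <;> norm_num

/-- **The pointwise cost of (16.6)'s two removals**: for `H ≥ 1`, `X > 0`, `d ≥ 1`, `0 ∉ S`,
`|U_d^{(H)}(β) - U_d^{0,(H)}(β)| ≤ log(4H) · ΣΣ_{4d ∣ Δ ≠ 0, ((z₁,z₂) ≠ 1 or |Δ| < 4dX)} |b_{z₁} b_{z₂}|` — the
cutoff `f(|Δ|/d)` equals `1` unless `|Δ| < 4dX`, and `0 ≤ u_H ≤ log 4H`.
[cite: FriedlanderIwaniecAnnals1998, (16.6) ("we remove the condition `(z₁,z₂) = 1` … by a trivial estimation"; "the factor `f(|Δ|/d)` is not needed in (16.6)")] -/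
theorem abs_fiUdMoll_sub_fiUd0_le {X H : ℝ} (hX : 0 < X) (hH : 1 ≤ H) {d : ℕ} (hd : 1 ≤ d)
    {S : Finset GaussianInt} (h0 : (0 : GaussianInt) ∉ S) (b : GaussianInt → ℝ) :
    |fiUdMoll X H d S b - fiUd0 H d S b| ≤
      Real.log (4 * H) * ∑ z₁ ∈ S, ∑ z₂ ∈ S,
        if d ∈ fiModuli z₁ z₂ ∧ (¬ GaussCoprime z₁ z₂ ∨ |(fiDelta z₁ z₂ : ℝ)| < 4 * d * X) then
          |b z₁ * b z₂| else 0 := by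
  rw [fiUd0_eq_sum_fiModuli H d h0 b]
  unfold fiUdMoll
  rw [← sum_sub_distrib, Finset.mul_sum]
  refine (abs_sum_le_sum_abs _ _).trans (sum_le_sum fun z₁ _ => ?_)
  rw [← sum_sub_distrib, Finset.mul_sum]
  refine (abs_sum_le_sum_abs _ _).trans (sum_le_sum fun z₂ _ => ?_)
  have hlog : 0 ≤ Real.log (4 * H) := Real.log_nonneg (by linarith)
  obtain ⟨hu0, hu1⟩ := logSineMollifier_mem_Icc hH (gaussArg z₁ - gaussArg z₂)
  set u := logSineMollifier H (gaussArg z₁ - gaussArg z₂) with hu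
  have hχ := us_abs_fiChi_le d z₁ z₂
  have hdpos : (0 : ℝ) < d := by exact_mod_cast hd
  by_cases hm : d ∈ fiModuli z₁ z₂
  · rw [if_pos hm]
    -- the common bound `|b b χ u| ≤ log(4H) |b b|`
    have hcore : |b z₁ * b z₂ * (fiChi d z₁ z₂ : ℝ) * u| ≤ Real.log (4 * H) * |b z₁ * b z₂| := by
      rw [abs_mul, abs_mul, abs_of_nonneg hu0]
      calc |b z₁ * b z₂| * |(fiChi d z₁ z₂ : ℝ)| * u ≤ |b z₁ * b z₂| * 1 * Real.log (4 * H) := by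
            gcongr
        _ = Real.log (4 * H) * |b z₁ * b z₂| := by ring
    by_cases hc : GaussCoprime z₁ z₂
    · rw [if_pos ⟨hc, hm⟩]
      by_cases hsmall : |(fiDelta z₁ z₂ : ℝ)| < 4 * d * X
      · rw [if_pos ⟨hm, Or.inr hsmall⟩]
        have hf := fiTenF_mem_Icc X (|(fiDelta z₁ z₂ : ℝ)| / d)
        -- `|(f - 1) b b χ u| ≤ |b b χ u|`
        have e : fiTenF X (|(fiDelta z₁ z₂ : ℝ)| / d) * (b z₁ * b z₂) * (fiChi d z₁ z₂ : ℝ) * u -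
            b z₁ * b z₂ * (fiChi d z₁ z₂ : ℝ) * u =
            (fiTenF X (|(fiDelta z₁ z₂ : ℝ)| / d) - 1) * (b z₁ * b z₂ * (fiChi d z₁ z₂ : ℝ) * u) := by ring
        rw [e, abs_mul]
        have h1 : |fiTenF X (|(fiDelta z₁ z₂ : ℝ)| / d) - 1| ≤ 1 := by
          rw [abs_le]; constructor <;> linarith [hf.1, hf.2]
        calc |fiTenF X (|(fiDelta z₁ z₂ : ℝ)| / d) - 1| * |b z₁ * b z₂ * (fiChi d z₁ z₂ : ℝ) * u|
            ≤ 1 * (Real.log (4 * H) * |b z₁ * b z₂|) := mul_le_mul h1 hcore (abs_nonneg _) zero_le_one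
          _ = _ := one_mul _
      · -- `|Δ| ≥ 4dX`: `f = 1`, no cost
        have hf1 : fiTenF X (|(fiDelta z₁ z₂ : ℝ)| / d) = 1 :=
          fiTenF_eq_one hX (by rw [le_div_iff₀ hdpos]; linarith [not_lt.mp hsmall])
        rw [hf1, one_mul, sub_self, abs_zero]
        split_ifs <;> positivity
    · rw [if_neg (fun h => hc h.1), if_pos ⟨hm, Or.inl hc⟩, zero_sub, abs_neg]
      exact hcore
  · rw [if_neg hm, if_neg (fun h => hm h.2), if_neg (fun h => hm h.1), sub_zero, abs_zero, mul_zero]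

/-! ### (16.10) for the printed block: the harmonics separate into a hermitian form -/

/-- The separated double sum of (16.10) for the printed block:
`S_d^0(k) = ΣΣ_{z₁,z₂ ∈ S, 4d ∣ Δ} b_{z₁} b_{z₂} ((z₂/z₁)/d) (z₁z̄₂/(|z₁||z₂|))^k`. [cite: FriedlanderIwaniecAnnals1998, (16.10)] -/
def fiSd0 (d : ℕ) (S : Finset GaussianInt) (b : GaussianInt → ℝ) (k : ℤ) : ℂ :=
  ∑ z₁ ∈ S, ∑ z₂ ∈ S,
    if (4 * (d : ℤ)) ∣ fiDelta z₁ z₂ then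
      ((b z₁ * b z₂ * (fiChi d z₁ z₂ : ℝ) : ℝ) : ℂ) *
        (GaussianInt.toComplex z₁ * conj (GaussianInt.toComplex z₂) /
          ((‖GaussianInt.toComplex z₁‖ * ‖GaussianInt.toComplex z₂‖ : ℝ) : ℂ)) ^ k
    else 0

/-- **The harmonic of a pair is hermitian**: `(z₁z̄₂/(|z₁||z₂|))^k = (z₁/|z₁|)^k · conj((z₂/|z₂|)^k)` — so
`S_d^0(k)` is the form `ΣΣ_{4d∣Δ} χ_d · c_k(z₁) · conj(c_k(z₂))` with `c_k(z) = b_z (z/|z|)^k`, the input shape of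
the detection identity (16.11). [cite: FriedlanderIwaniecAnnals1998, (16.10)–(16.11) and (16.14)] -/
theorem harmonic_pair_eq (z₁ z₂ : ℂ) (k : ℤ) :
    (z₁ * conj z₂ / ((‖z₁‖ * ‖z₂‖ : ℝ) : ℂ)) ^ k = (z₁ / (‖z₁‖ : ℂ)) ^ k * conj ((z₂ / (‖z₂‖ : ℂ)) ^ k) := by
  rw [map_zpow₀, map_div₀, Complex.conj_ofReal, ← mul_zpow, div_mul_div_comm, Complex.ofReal_mul]

/-- `U_d^{0,(H)}` as a weighted sum of `u_H(α₁ - α₂)` over the pairs, in `ℂ`. [folklore] -/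
private theorem us_fiUd0_eq_sum_pairs (H : ℝ) (d : ℕ) (S : Finset GaussianInt) (b : GaussianInt → ℝ) :
    (fiUd0 H d S b : ℂ) =
      ∑ i ∈ S ×ˢ S, ((if (4 * (d : ℤ)) ∣ fiDelta i.1 i.2 then b i.1 * b i.2 * (fiChi d i.1 i.2 : ℝ) else 0 : ℝ) : ℂ) *
        ((logSineMollifier H (gaussArg i.1 - gaussArg i.2) : ℝ) : ℂ) := by
  unfold fiUd0
  push_cast
  rw [Finset.sum_product]
  refine sum_congr rfl fun z₁ _ => sum_congr rfl fun z₂ _ => ?_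
  split_ifs <;> push_cast <;> ring

/-- The harmonics of `S_d^0(k)` termwise (`0 ∉ S`). [folklore] -/
private theorem us_fiSd0_eq_sum_pairs (d : ℕ) {S : Finset GaussianInt} (h0 : (0 : GaussianInt) ∉ S)
    (b : GaussianInt → ℝ) (k : ℤ) :
    fiSd0 d S b k =
      ∑ i ∈ S ×ˢ S, ((if (4 * (d : ℤ)) ∣ fiDelta i.1 i.2 then b i.1 * b i.2 * (fiChi d i.1 i.2 : ℝ) else 0 : ℝ) : ℂ) *
        Complex.exp (k * ((gaussArg i.1 - gaussArg i.2 : ℝ) : ℝ) * I) := by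
  unfold fiSd0
  rw [Finset.sum_product]
  refine sum_congr rfl fun z₁ hz₁ => sum_congr rfl fun z₂ hz₂ => ?_
  have hz₁' : GaussianInt.toComplex z₁ ≠ 0 := fun h => h0 ((GaussianInt.toComplex_eq_zero.mp h) ▸ hz₁)
  have hz₂' : GaussianInt.toComplex z₂ ≠ 0 := fun h => h0 ((GaussianInt.toComplex_eq_zero.mp h) ▸ hz₂)
  split_ifs with h4
  · congr 1
    unfold gaussArg
    exact (exp_int_mul_arg_sub_mul_I hz₁' hz₂' k).symm
  · push_cast; rw [zero_mul]

/-- **(16.9) ⇒ (16.10) for the printed block.**  There is an absolute `C > 0` and, for every `H ≥ 2`, one sequence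
`û_H` (`|û_H(k)| ≤ log 4H`, `Σ_k |û_H(k)| ≤ C log²(4H)`) such that for every `d`, every finite `S ∌ 0`, all real
weights and every `K ≥ 1`:
`‖U_d^{0,(H)}(β) - Σ_{|k| ≤ K} û_H(k) S_d^0(k)‖ ≤ C·H·log(4H)·K⁻¹ · ΣΣ_{4d ∣ Δ} |b_{z₁} b_{z₂} ((z₂/z₁)/d)|`.
[cite: FriedlanderIwaniecAnnals1998, (16.9)–(16.10)] -/
theorem exists_fiUd0_trunc : ∃ C : ℝ, 0 < C ∧ ∀ H : ℝ, 2 ≤ H →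
    ∃ c : ℤ → ℂ, (∀ k, ‖c k‖ ≤ Real.log (4 * H)) ∧ (Summable fun k => ‖c k‖) ∧
      (∑' k : ℤ, ‖c k‖ ≤ C * Real.log (4 * H) ^ 2) ∧
      ∀ (d : ℕ) (S : Finset GaussianInt), (0 : GaussianInt) ∉ S → ∀ (b : GaussianInt → ℝ) (K : ℕ), 1 ≤ K →
        ‖(fiUd0 H d S b : ℂ) - ∑ k ∈ Finset.Icc (-(K : ℤ)) K, c k * fiSd0 d S b k‖ ≤
          C * H * Real.log (4 * H) / K *
            ∑ i ∈ S ×ˢ S, |(if (4 * (d : ℤ)) ∣ fiDelta i.1 i.2 then b i.1 * b i.2 * (fiChi d i.1 i.2 : ℝ) else 0 : ℝ)| := by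
  obtain ⟨C, hC, hmain⟩ := exists_logSineMollifier_separation.{0}
  refine ⟨C, hC, fun H hH => ?_⟩
  obtain ⟨c, hc0, hsum, htsum, -, -, htrunc⟩ := hmain H hH
  refine ⟨c, hc0, hsum, htsum, fun d S h0 b K hK => ?_⟩
  have h := htrunc (GaussianInt × GaussianInt) (S ×ˢ S)
    (fun i => ((if (4 * (d : ℤ)) ∣ fiDelta i.1 i.2 then b i.1 * b i.2 * (fiChi d i.1 i.2 : ℝ) else 0 : ℝ) : ℂ))
    (fun i => gaussArg i.1 - gaussArg i.2) K hK
  rw [us_fiUd0_eq_sum_pairs]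
  simp_rw [us_fiSd0_eq_sum_pairs d h0 b]
  simp_rw [Complex.norm_real, Real.norm_eq_abs] at h
  convert h using 3

end Literature.NumberTheory.Sieve.FriedlanderIwaniecPrimes
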